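import Mathlib
import Summits.Ventures.HodgeRepro2.Tier7.Line3.AdicValuationInvariant

/-!
# Tier7/Line3/AdicValuationInvariantPrimesOver — the hypotheses of `valuation_galRestrict` in Mathlib's vocabulary
(seat t7-x1, gen 4; a ≤ 60-line bridge for the assembly)

LINE 3 (t7-plan-3), version (ii). AdicValuationInvariant.valuation_galRestrict takes the two clauses `hw : w.asIdeal.comap
(algebraMap (𝓞 K) (𝓞 E)) = v.asIdeal` and `huniq : ∀ w', w'.asIdeal.comap … = v.asIdeal → w' = w`. This module restates
them in Mathlib's vocabulary: `hw` is the instance `w.asIdeal.LiesOver v.asIdeal` (`comap_eq_of_liesOver`), and `huniq` is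
«the set `primesOver v.asIdeal (𝓞 E)` has at most one element» (`huniq_of_subsingleton`; `huniq_of_ncard_eq_one` for
`ncard = 1`). `valuation_galRestrict_of_subsingleton` / `_of_ncard_eq_one` are the assembled clauses: for `σ ∈ Gal(E/K)`,
`w` lying over `v`, and one prime of `E` above `v` — the dictionary's INERT `v₁` — `w.valuation E (σ x) = w.valuation E x`.
DICTIONARY (in words): `K = E⁺`, `E` the CM field, `σ` its involution, `v = v₁` inert, `w` the place above it. Nothing here
is about (N), (P), the real `X`, or HC_CM; §8(d): NO. Blind lane: Mathlib + the HodgeRepro2 prefix; no sorry;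
axioms ⊆ {propext, Classical.choice, Quot.sound}.
-/

namespace Summit.Ventures.HodgeRepro2.Tier7.Line3.AdicValuationInvariant

open IsDedekindDomain IsDedekindDomain.HeightOneSpectrum NumberField
open scoped NumberField

variable {K E : Type*} [Field K] [NumberField K] [Field E] [NumberField E] [Algebra K E]
  (w : HeightOneSpectrum (𝓞 E)) (v : HeightOneSpectrum (𝓞 K))

omit [NumberField K] [NumberField E] in
/-- `hw` from the `LiesOver` instance. -/
theorem comap_eq_of_liesOver [w.asIdeal.LiesOver v.asIdeal] :
    w.asIdeal.comap (algebraMap (𝓞 K) (𝓞 E)) = v.asIdeal :=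
  (Ideal.over_def w.asIdeal v.asIdeal).symm

omit [NumberField K] [NumberField E] in
/-- `huniq` from «at most one prime above `v`». -/
theorem huniq_of_subsingleton [w.asIdeal.LiesOver v.asIdeal] (h : (Ideal.primesOver v.asIdeal (𝓞 E)).Subsingleton) :
    ∀ w' : HeightOneSpectrum (𝓞 E), w'.asIdeal.comap (algebraMap (𝓞 K) (𝓞 E)) = v.asIdeal → w' = w := by
  intro w' hw'
  haveI : w'.asIdeal.LiesOver v.asIdeal := ⟨hw'.symm⟩
  have h1 : w'.asIdeal ∈ Ideal.primesOver v.asIdeal (𝓞 E) := ⟨w'.isPrime, inferInstance⟩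
  have h2 : w.asIdeal ∈ Ideal.primesOver v.asIdeal (𝓞 E) := ⟨w.isPrime, inferInstance⟩
  exact HeightOneSpectrum.ext (h h1 h2)

omit [NumberField K] [NumberField E] in
/-- `huniq` from «exactly one prime above `v`». -/
theorem huniq_of_ncard_eq_one [w.asIdeal.LiesOver v.asIdeal] (h : (Ideal.primesOver v.asIdeal (𝓞 E)).ncard = 1) :
    ∀ w' : HeightOneSpectrum (𝓞 E), w'.asIdeal.comap (algebraMap (𝓞 K) (𝓞 E)) = v.asIdeal → w' = w := by
  obtain ⟨P, hP⟩ := Set.ncard_eq_one.1 h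
  exact huniq_of_subsingleton w v (by rw [hP]; exact Set.subsingleton_singleton)

variable (σ : E ≃ₐ[K] E)

/-- **the Galois automorphism preserves the `w`-adic valuation when `w` lies over `v` and `v` has at most one prime
above it** (Mathlib's vocabulary: `LiesOver` + `primesOver`). -/
theorem valuation_galRestrict_of_subsingleton [w.asIdeal.LiesOver v.asIdeal]
    (h : (Ideal.primesOver v.asIdeal (𝓞 E)).Subsingleton) (x : E) :
    w.valuation E ((σ : E →+* E) x) = w.valuation E x :=
  valuation_galRestrict w σ v (comap_eq_of_liesOver w v) (huniq_of_subsingleton w v h) x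

/-- the same with «exactly one prime above `v`». -/
theorem valuation_galRestrict_of_ncard_eq_one [w.asIdeal.LiesOver v.asIdeal]
    (h : (Ideal.primesOver v.asIdeal (𝓞 E)).ncard = 1) (x : E) :
    w.valuation E ((σ : E →+* E) x) = w.valuation E x :=
  valuation_galRestrict w σ v (comap_eq_of_liesOver w v) (huniq_of_ncard_eq_one w v h) x

end Summit.Ventures.HodgeRepro2.Tier7.Line3.AdicValuationInvariant
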